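import Summits.CriticalPhenomena.SAWScalingLimit.Theorems.SAWTotalPositivityCriticalBubbleBoundJoinMacroInjection
import Summits.CriticalPhenomena.SAWScalingLimit.Theorems.SAWTotalPositivityCriticalBubbleBoundJoinMacroFloor
import Summits.CriticalPhenomena.SAWScalingLimit.Theorems.SAWTotalPositivityCriticalBubbleBoundJoinLedgerDoor

/-!
# The MACROSCOPIC DOOR of the join-mass programme (stubs `criticalBubbleBound_of_joinEntropyAt_of_joinMacroRarity`,
`criticalBubbleBound_of_joinMacroRarity` of line `docking-census-joining`, crux stmt-CriticalPhenomena-7117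
`Summit.CriticalPhenomena.SAWScalingLimit.Theses.SAWTotalPositivity.CriticalBubbleBound`; lead prover c7)

Hammond's polygon joining (Ann. Probab. 46 (2018) §4), run in `x_c`-mass through the docking line's
ledger `θ - 1 = κ + π`, has entropy `κ = 3/2` PROVED (`Join.joinEntropyAt_three_halves`, from
`Join.Dent_ge`) and rarity `π = 0` PROVED for root/right-column GLOBAL join plaquettes — where `0` is sharp.
The join's images are MACROSCOPIC global join plaquettes (each flipped half carries at least a quarter
of the edges: `Join.joinPoly_sides_card`, `Join.joinPoly_reroot_macro`), so the injection survives the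
restriction of the rarity side to `Umac` (`Join.Dent_le_Umac`), and the abstract door
`Join.criticalBubbleBound_of_ledger` yields:

* `criticalBubbleBound_of_joinEntropyAt_of_joinMacroRarity` — for `0 ≤ κ`, `κ + π > 2`:
  `JoinEntropyAt κ → JoinMacroRarity π → CriticalBubbleBound` (the parametric door: entropy and
  macroscopic rarity may be traded; conjecturally `κ = 1 + ν = 7/4`, `π = ν (x₄ - 2) = 11/16`);
* `criticalBubbleBound_of_joinMacroRarity` — with the proved `κ = 3/2`:
  `1/2 < π → JoinMacroRarity π → CriticalBubbleBound`.

This is the line's NEW COMPOSITION: the crux follows from ONE exponent statement, the rarity of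
MACROSCOPIC global join plaquettes with any gain `π > 1/2` (heuristic `11/16`, margin `3/16`; proved
floor `Join.joinMacroRarity_zero`). Everything here is sorry-free; the crux item is NOT closed by this
file (`JoinMacroRarity π` for `π > 1/2` is an open conjecture of this programme, not a result in print).
-/

noncomputable section

open Literature.Probability.LatticeModels
open Literature.Probability.RandomPlanarGeometry Literature.Probability.RandomPlanarGeometry.SAW
open scoped BigOperators ENNReal
open Summit.CriticalPhenomena.SAWScalingLimit.Theorems.CriticalBubbleBound.Negative (e₀)
open Summit.CriticalPhenomena.SAWScalingLimit.Theorems.CriticalBubbleBound.Docking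

namespace Summit.CriticalPhenomena.SAWScalingLimit.Theorems.CriticalBubbleBound.Join

/-- The entropy mass of the macroscopic door: `Dent` truncated below scale `6` (where the injection
`Dent_le_Umac` is available); the entropy inequality survives from scale `max i₀ 6` on and the
injection `≤ 64 x_c^{-16} · Umac` holds at every scale. [cite: Hammond2015SAPJoining, Lemma 4.12] -/
theorem truncatedDent_macro_spec {κ c : ℝ} {i₀ : ℕ}
    (hent : ∀ i : ℕ, i₀ ≤ i → c * (2 : ℝ) ^ ((κ - 1) * (i : ℝ)) * blockMass jterm i ^ 2 ≤ Dent i) :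
    (∀ i : ℕ, max i₀ 6 ≤ i →
        c * (2 : ℝ) ^ ((κ - 1) * (i : ℝ)) * blockMass jterm i ^ 2 ≤
          (fun i => if 6 ≤ i then Dent i else 0) i) ∧
      (∀ i : ℕ, (fun i => if 6 ≤ i then Dent i else 0) i ≤ 64 * criticalFugacity⁻¹ ^ 16 * Umac i) := by
  have hK₁ : (0 : ℝ) < 64 * criticalFugacity⁻¹ ^ 16 :=
    mul_pos (by norm_num) (pow_pos (inv_pos.2 criticalFugacity_pos_lt_one'.1) 16)
  refine ⟨fun i hi => ?_, fun i => ?_⟩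
  · have h6 : 6 ≤ i := le_trans (le_max_right _ _) hi
    dsimp only
    rw [if_pos h6]
    exact hent i (le_trans (le_max_left _ _) hi)
  · dsimp only
    split_ifs with h6
    · exact Dent_le_Umac i h6
    · exact mul_nonneg hK₁.le (Umac_nonneg i)

/-- **The parametric macroscopic door.** For `0 ≤ κ` and `κ + π > 2`, join entropy with exponent `κ`
and macroscopic join rarity with exponent `π` imply the crux: the abstract ledger door
`criticalBubbleBound_of_ledger` fed with `D :=` the truncated entropy mass, `U := Umac`, the injection
`Dent_le_Umac` (`K₁ = 64 x_c^{-16}`) and the two hypotheses. (Registered sub-goal of the crux item;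
conjectural values `κ = 7/4`, `π = 11/16`.) [cite: Hammond2015SAPJoining, §4] -/
theorem criticalBubbleBound_of_joinEntropyAt_of_joinMacroRarity : ∀ κ π : ℝ, 0 ≤ κ → 2 < κ + π → JoinEntropyAt κ → JoinMacroRarity π → Summit.CriticalPhenomena.SAWScalingLimit.Theses.SAWTotalPositivity.CriticalBubbleBound := by
  intro κ π hκ hsum hent hrar
  obtain ⟨c, hc, i₀, hent⟩ := hent
  obtain ⟨hent', hinj⟩ := truncatedDent_macro_spec hent
  have hK₁ : (0 : ℝ) < 64 * criticalFugacity⁻¹ ^ 16 :=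
    mul_pos (by norm_num) (pow_pos (inv_pos.2 criticalFugacity_pos_lt_one'.1) 16)
  exact criticalBubbleBound_of_ledger κ π (fun i => if 6 ≤ i then Dent i else 0) Umac hκ hsum
    ⟨c, hc, max i₀ 6, hent'⟩ ⟨64 * criticalFugacity⁻¹ ^ 16, hK₁, hinj⟩ hrar

/-- **The macroscopic door.** With the PROVED join entropy `κ = 3/2` (`joinEntropyAt_three_halves`,
Hammond's Lemma 4.12 for tall classes), ANY rarity gain `π > 1/2` for MACROSCOPIC global join plaquettes
implies the crux `CriticalBubbleBound`. This is the new composition of line `docking-census-joining`: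
one open exponent statement (`JoinMacroRarity π`, heuristic `π₀ = 11/16`, proved floor `π = 0`).
(Registered sub-goal of the crux item; the crux stays open.) [cite: Hammond2015SAPJoining, §4] -/
theorem criticalBubbleBound_of_joinMacroRarity : ∀ π : ℝ, 1 / 2 < π → JoinMacroRarity π → Summit.CriticalPhenomena.SAWScalingLimit.Theses.SAWTotalPositivity.CriticalBubbleBound := by
  intro π hπ hrar
  exact criticalBubbleBound_of_joinEntropyAt_of_joinMacroRarity (3 / 2) π (by norm_num) (by linarith)
    joinEntropyAt_three_halves hrar

end Summit.CriticalPhenomena.SAWScalingLimit.Theorems.CriticalBubbleBound.Join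

end
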